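import Literature.Analysis.FluidPDE.NSFourierBilinear
import Mathlib.MeasureTheory.Integral.MeanInequalities
import Mathlib.MeasureTheory.Function.ContinuousMapDense
import Mathlib.Analysis.LConvolution
import HarnessLib

/-!
# Frequency convolutions of square-integrable coefficient functions

First file of the weighted-`L²` (Sobolev class) Fourier-side construction of the local smooth
solution of the Navier–Stokes system with `H¹`-controlled lifespan (discharge of
`Literature.Analysis.FluidPDE.tao2011_fourier_local_existence`, Tao 2013, Thm. 5.4 (ii)+(iv);
plan in `TaoH1FourierDecomposition`). The tree's pointwise pipeline (`NSFourierBilinear`,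
`NSFourierPicard`, …) estimates the frequency convolution `(f ⋆ g)(ξ) = ∫ f(η) g(ξ - η) dη`
(`FourierNS.fconv`, the Fourier image of the product `𝓕f · 𝓕g`) in weighted sup norms
`sup (1 + ‖ξ‖)^K ‖f(ξ)‖`. For data that are only weighted square integrable (the transform of a
general `H^∞` field) the basic tool is instead the **majorant convolution** of non-negative
extended-real functions, Mathlib's `lintegral` convolution

  `(Φ ⋆ₗ Ψ) ξ = ∫⁻ η, Φ η * Ψ (ξ - η)`   (`MeasureTheory.lconvolution`, `lconv_apply`),

for which Tonelli's theorem holds unconditionally. This file provides: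

* `enorm_fconv_le_lconv`: `‖(f ⋆ g)(ξ)‖ₑ ≤ (‖f‖ₑ ⋆ₗ ‖g‖ₑ) ξ` (always);
* `lconv_le_sqrt_mul_sqrt`: the Cauchy–Schwarz bound `(Φ ⋆ₗ Ψ) ξ ≤ ‖Φ‖_{L²} ‖Ψ‖_{L²}`
  (pointwise boundedness of the convolution of two `L²` functions), and its form
  `enorm_fconv_le` for `fconv`;
* Peetre-type weight distribution
  `(1 + ‖ξ‖)^K (Φ ⋆ₗ Ψ) ≤ 2^K (Φ ⋆ₗ (w^K Ψ) + (w^K Φ) ⋆ₗ Ψ)` and its homogeneous forms for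
  the weights `‖ξ‖`, `‖ξ‖²` (`weight_mul_lconv_le`, `norm_mul_lconv_le`, `norm_sq_mul_lconv_le`),
  and the resulting *pointwise* polynomial decay of `f ⋆ g` from weighted-`L²` bounds
  (`weight_mul_enorm_fconv_le`);
* the elementary Young inequality `‖Φ ⋆ₗ Ψ‖_{L²} ≤ ‖Φ‖_{L²} ‖Ψ‖_{L¹}` in squared `lintegral`
  form (`lintegral_lconv_sq_le`);
* `sq_lintegral_le_weight`: `‖Φ‖_{L¹} ≤ ‖(1 + ‖·‖)^{-m}‖_{L²} ‖(1 + ‖·‖)^m Φ‖_{L²}` (finite for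
  `2m > dim`, `lintegral_weight_inv_sq_lt_top`);
* integrability of the `fconv` integrand and continuity of `f ⋆ g` for `f, g ∈ L²`
  (`continuous_fconv_of_memLp`, by density of `C_c` in `L²` and the uniform Cauchy–Schwarz
  bound), and joint continuity of `(x, ξ) ↦ (F x ⋆ G x)(ξ)` for `L²`-continuous families
  (`continuous_fconv_family`) — the form in which the Fourier-side Navier–Stokes nonlinearity of
  an `L²`-continuous trajectory is jointly continuous in time and frequency.

(Standard real-variable facts; for the role of `L²_ξ`-based convolution estimates in the
Navier–Stokes theory cf. Lemarié-Rieusset 2016, §8.5, and Tao 2013, §2, arXiv Lemma 23, whose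
bilinear estimate is proved on the Fourier side in the sequel file.)

## Mathlib search

`MeasureTheory.lconvolution` (`Mathlib.Analysis.LConvolution`: the `lintegral` convolution
`Φ ⋆ₗ Ψ` with measurability, associativity and commutativity only — used here as is),
`ENNReal.lintegral_mul_le_Lp_mul_Lq` (Hölder for `lintegral`), `lintegral_sub_right_eq_self`,
`lintegral_sub_left_eq_self` (translation invariance), `lintegral_lintegral_swap` (Tonelli),
`MeasureTheory.MemLp.exists_hasCompactSupport_eLpNorm_sub_le` (density of `C_c` in `L^p`),
`HasCompactSupport.continuous_convolution_right`, `TendstoUniformly.continuous`. No Mathlib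
statement of Young's inequality for `lconvolution` or of the continuity of `L² ⋆ L²` was found
(searched `Young`, `lconvolution`, `continuous_convolution`).

## References

* P. G. Lemarié-Rieusset, *The Navier–Stokes problem in the 21st century*, CRC 2016, §8.5.
* T. Tao, Anal. PDE 6 (2013) = arXiv:1108.1165, §2. [Tao2011]
-/

noncomputable section

open MeasureTheory Real Set Filter Function
open scoped ENNReal NNReal Convolution
open _root_.Topology

namespace Literature.Analysis.FluidPDE.FourierNS

variable {ι : Type*} [Fintype ι]

/-! ### The majorant convolution `Φ ⋆ₗ Ψ` on `ℝ≥0∞`-valued functions -/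

section LConv

variable {Φ Ψ Φ' Ψ' : EuclideanSpace ℝ ι → ℝ≥0∞}

/-- The **majorant convolution** in the `ξ - η` form used throughout:
`(Φ ⋆ₗ Ψ) ξ = ∫⁻ η, Φ η * Ψ (ξ - η)` (Mathlib writes `Ψ (-η + ξ)`). [folklore] -/
theorem lconv_apply (Φ Ψ : EuclideanSpace ℝ ι → ℝ≥0∞) (ξ : EuclideanSpace ℝ ι) :
    (Φ ⋆ₗ Ψ) ξ = ∫⁻ η, Φ η * Ψ (ξ - η) := by
  simp only [lconvolution_def, neg_add_eq_sub]

/-- Monotonicity of `⋆ₗ` in both arguments. [folklore] -/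
theorem lconv_mono (hΦ : Φ ≤ Φ') (hΨ : Ψ ≤ Ψ') (ξ : EuclideanSpace ℝ ι) :
    (Φ ⋆ₗ Ψ) ξ ≤ (Φ' ⋆ₗ Ψ') ξ := by
  rw [lconv_apply, lconv_apply]
  exact lintegral_mono fun η => mul_le_mul' (hΦ η) (hΨ _)

/-- `⋆ₗ` commutes with constant multiples on the left. [folklore] -/
theorem lconv_const_mul_left (C : ℝ≥0∞) (hC : C ≠ ⊤) (ξ : EuclideanSpace ℝ ι) :
    ((fun η => C * Φ η) ⋆ₗ Ψ) ξ = C * (Φ ⋆ₗ Ψ) ξ := by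
  simp only [lconv_apply, mul_assoc]
  exact lintegral_const_mul' _ _ hC

/-- `⋆ₗ` commutes with constant multiples on the right. [folklore] -/
theorem lconv_const_mul_right (C : ℝ≥0∞) (hC : C ≠ ⊤) (ξ : EuclideanSpace ℝ ι) :
    (Φ ⋆ₗ (fun η => C * Ψ η)) ξ = C * (Φ ⋆ₗ Ψ) ξ := by
  simp only [lconv_apply]
  rw [← lintegral_const_mul' _ _ hC]
  congr 1 with η
  ring

/-- Measurability of the reflected-translated factor `η ↦ Ψ (ξ - η)`. [folklore] -/
theorem aemeasurable_comp_sub_left (hΨ : AEMeasurable Ψ volume) (ξ : EuclideanSpace ℝ ι) :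
    AEMeasurable (fun η => Ψ (ξ - η)) volume :=
  hΨ.comp_quasiMeasurePreserving (quasiMeasurePreserving_sub_left volume ξ)

/-- `⋆ₗ` is additive on the left. [folklore] -/
theorem lconv_add_left (hΦ : AEMeasurable Φ volume) (hΨ : AEMeasurable Ψ volume)
    (ξ : EuclideanSpace ℝ ι) :
    ((Φ + Φ') ⋆ₗ Ψ) ξ = (Φ ⋆ₗ Ψ) ξ + (Φ' ⋆ₗ Ψ) ξ := by
  simp only [lconv_apply, Pi.add_apply, add_mul]
  exact lintegral_add_left' (hΦ.mul (aemeasurable_comp_sub_left hΨ ξ)) _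

/-- `⋆ₗ` is additive on the right. [folklore] -/
theorem lconv_add_right (hΦ : AEMeasurable Φ volume) (hΨ : AEMeasurable Ψ volume)
    (ξ : EuclideanSpace ℝ ι) :
    (Φ ⋆ₗ (Ψ + Ψ')) ξ = (Φ ⋆ₗ Ψ) ξ + (Φ ⋆ₗ Ψ') ξ := by
  simp only [lconv_apply, Pi.add_apply, mul_add]
  exact lintegral_add_left' (hΦ.mul (aemeasurable_comp_sub_left hΨ ξ)) _

/-! ### Cauchy–Schwarz: pointwise boundedness of `L² ⋆ L²` -/

/-- The square-norm functional `∫⁻ Ψ²` is invariant under `η ↦ ξ - η`. [folklore] -/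
theorem lintegral_sq_comp_sub_left (Ψ : EuclideanSpace ℝ ι → ℝ≥0∞) (ξ : EuclideanSpace ℝ ι) :
    ∫⁻ η, Ψ (ξ - η) ^ 2 = ∫⁻ η, Ψ η ^ 2 :=
  lintegral_sub_left_eq_self (μ := (volume : Measure (EuclideanSpace ℝ ι))) (fun η => Ψ η ^ 2) ξ

/-- `∫⁻ Θ ^ (2 : ℝ) = ∫⁻ Θ ^ 2` (real versus natural exponent). [folklore] -/
theorem lintegral_rpow_two_eq {α : Type*} [MeasurableSpace α] (μ : Measure α) (Θ : α → ℝ≥0∞) :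
    ∫⁻ a, Θ a ^ (2 : ℝ) ∂μ = ∫⁻ a, Θ a ^ 2 ∂μ :=
  lintegral_congr fun a => by rw [show (2 : ℝ) = (2 : ℕ) by norm_num, ENNReal.rpow_natCast]

/-- **Cauchy–Schwarz for the majorant convolution**:
`(Φ ⋆ₗ Ψ) ξ ≤ (∫⁻ Φ²)^{1/2} (∫⁻ Ψ²)^{1/2}` for every `ξ` — the convolution of two
square-integrable functions is bounded (Hölder for `lintegral` with `p = q = 2` and translation
invariance). [folklore] -/
theorem lconv_le_sqrt_mul_sqrt (hΦ : AEMeasurable Φ volume) (hΨ : AEMeasurable Ψ volume)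
    (ξ : EuclideanSpace ℝ ι) :
    (Φ ⋆ₗ Ψ) ξ ≤ (∫⁻ η, Φ η ^ 2) ^ (1 / 2 : ℝ) * (∫⁻ η, Ψ η ^ 2) ^ (1 / 2 : ℝ) := by
  have h := ENNReal.lintegral_mul_le_Lp_mul_Lq volume (Real.HolderConjugate.two_two) hΦ
    (aemeasurable_comp_sub_left hΨ ξ)
  simp only [Pi.mul_apply] at h
  rw [lconv_apply]
  refine h.trans (le_of_eq ?_)
  rw [lintegral_rpow_two_eq, lintegral_rpow_two_eq volume (fun η => Ψ (ξ - η)),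
    lintegral_sq_comp_sub_left]

/-! ### Distribution of weights (Peetre) -/

/-- `1 ≤ (1 + ‖ξ‖)^K` in `ℝ≥0∞`. [folklore] -/
theorem one_le_ofReal_weight (K : ℕ) (ξ : EuclideanSpace ℝ ι) :
    (1 : ℝ≥0∞) ≤ ENNReal.ofReal ((1 + ‖ξ‖) ^ K) := by
  rw [← ENNReal.ofReal_one]
  exact ENNReal.ofReal_le_ofReal (one_le_one_add_norm_pow ξ K)

/-- The weight `ξ ↦ (1 + ‖ξ‖)^K` is measurable as an `ℝ≥0∞`-valued function. [folklore] -/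
theorem measurable_ofReal_weight (K : ℕ) :
    Measurable fun ξ : EuclideanSpace ℝ ι => ENNReal.ofReal ((1 + ‖ξ‖) ^ K) :=
  (ENNReal.continuous_ofReal.comp (by fun_prop)).measurable

/-- Peetre's inequality in `ℝ≥0∞`: `w^K(ξ) ≤ 2^K (w^K(ξ - η) + w^K(η))`, `w = 1 + ‖·‖`.
[folklore] -/
theorem ofReal_weight_le (K : ℕ) (ξ η : EuclideanSpace ℝ ι) :
    ENNReal.ofReal ((1 + ‖ξ‖) ^ K) ≤
      2 ^ K * (ENNReal.ofReal ((1 + ‖ξ - η‖) ^ K) + ENNReal.ofReal ((1 + ‖η‖) ^ K)) := by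
  rw [← ENNReal.ofReal_add (by positivity) (by positivity),
    show (2 : ℝ≥0∞) ^ K = ENNReal.ofReal (2 ^ K) by
      rw [ENNReal.ofReal_pow (by norm_num), ENNReal.ofReal_ofNat],
    ← ENNReal.ofReal_mul (by positivity)]
  exact ENNReal.ofReal_le_ofReal (one_add_norm_pow_le ξ η K)

/-- **Weight distribution for `⋆ₗ`**:
`w^K(ξ) (Φ ⋆ₗ Ψ) ξ ≤ 2^K ((Φ ⋆ₗ (w^K Ψ)) ξ + ((w^K Φ) ⋆ₗ Ψ) ξ)`, `w = 1 + ‖·‖` (Peetre: the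
weight at `ξ` is dominated by the weights at `ξ - η` and `η`). [folklore] -/
theorem weight_mul_lconv_le (hΦ : AEMeasurable Φ volume) (hΨ : AEMeasurable Ψ volume) (K : ℕ)
    (ξ : EuclideanSpace ℝ ι) :
    ENNReal.ofReal ((1 + ‖ξ‖) ^ K) * (Φ ⋆ₗ Ψ) ξ ≤
      2 ^ K * ((Φ ⋆ₗ (fun η => ENNReal.ofReal ((1 + ‖η‖) ^ K) * Ψ η)) ξ +
        ((fun η => ENNReal.ofReal ((1 + ‖η‖) ^ K) * Φ η) ⋆ₗ Ψ) ξ) := by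
  have hm := aemeasurable_comp_sub_left hΨ ξ
  have hw : AEMeasurable (fun η => ENNReal.ofReal ((1 + ‖ξ - η‖) ^ K)) volume :=
    (measurable_ofReal_weight K).comp_aemeasurable (measurable_const.aemeasurable.sub
      aemeasurable_id)
  calc ENNReal.ofReal ((1 + ‖ξ‖) ^ K) * (Φ ⋆ₗ Ψ) ξ
      = ∫⁻ η, ENNReal.ofReal ((1 + ‖ξ‖) ^ K) * (Φ η * Ψ (ξ - η)) := by
        rw [lconv_apply, lintegral_const_mul' _ _ ENNReal.ofReal_ne_top]
    _ ≤ ∫⁻ η, 2 ^ K * (Φ η * (ENNReal.ofReal ((1 + ‖ξ - η‖) ^ K) * Ψ (ξ - η)) +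
          ENNReal.ofReal ((1 + ‖η‖) ^ K) * Φ η * Ψ (ξ - η)) := by
        refine lintegral_mono fun η => ?_
        calc ENNReal.ofReal ((1 + ‖ξ‖) ^ K) * (Φ η * Ψ (ξ - η))
            ≤ 2 ^ K * (ENNReal.ofReal ((1 + ‖ξ - η‖) ^ K) + ENNReal.ofReal ((1 + ‖η‖) ^ K)) *
                (Φ η * Ψ (ξ - η)) := by gcongr; exact ofReal_weight_le K ξ η
          _ = _ := by ring
    _ = _ := by
        rw [lintegral_const_mul' _ _ (by simp), lconv_apply, lconv_apply,
          ← lintegral_add_left' (f := fun η => Φ η *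
            (ENNReal.ofReal ((1 + ‖ξ - η‖) ^ K) * Ψ (ξ - η)))]
        exact hΦ.mul (hw.mul hm)

/-- Homogeneous weight distribution, first order:
`‖ξ‖ (Φ ⋆ₗ Ψ) ξ ≤ ((‖·‖ Φ) ⋆ₗ Ψ) ξ + (Φ ⋆ₗ (‖·‖ Ψ)) ξ` (triangle inequality
`‖ξ‖ ≤ ‖η‖ + ‖ξ - η‖`). [folklore] -/
theorem norm_mul_lconv_le (hΦ : AEMeasurable Φ volume) (hΨ : AEMeasurable Ψ volume)
    (ξ : EuclideanSpace ℝ ι) :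
    ENNReal.ofReal ‖ξ‖ * (Φ ⋆ₗ Ψ) ξ ≤
      ((fun η => ENNReal.ofReal ‖η‖ * Φ η) ⋆ₗ Ψ) ξ +
        (Φ ⋆ₗ (fun η => ENNReal.ofReal ‖η‖ * Ψ η)) ξ := by
  have hm := aemeasurable_comp_sub_left hΨ ξ
  have hn : AEMeasurable (fun η : EuclideanSpace ℝ ι => ENNReal.ofReal ‖η‖) volume :=
    (ENNReal.continuous_ofReal.comp continuous_norm).measurable.aemeasurable
  calc ENNReal.ofReal ‖ξ‖ * (Φ ⋆ₗ Ψ) ξ = ∫⁻ η, ENNReal.ofReal ‖ξ‖ * (Φ η * Ψ (ξ - η)) := by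
        rw [lconv_apply, lintegral_const_mul' _ _ ENNReal.ofReal_ne_top]
    _ ≤ ∫⁻ η, ENNReal.ofReal ‖η‖ * Φ η * Ψ (ξ - η) +
          Φ η * (ENNReal.ofReal ‖ξ - η‖ * Ψ (ξ - η)) := by
        refine lintegral_mono fun η => ?_
        have htri : ENNReal.ofReal ‖ξ‖ ≤ ENNReal.ofReal ‖η‖ + ENNReal.ofReal ‖ξ - η‖ := by
          rw [← ENNReal.ofReal_add (norm_nonneg _) (norm_nonneg _)]
          refine ENNReal.ofReal_le_ofReal ?_
          calc ‖ξ‖ = ‖η + (ξ - η)‖ := by rw [add_sub_cancel]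
            _ ≤ ‖η‖ + ‖ξ - η‖ := norm_add_le _ _
        calc ENNReal.ofReal ‖ξ‖ * (Φ η * Ψ (ξ - η))
            ≤ (ENNReal.ofReal ‖η‖ + ENNReal.ofReal ‖ξ - η‖) * (Φ η * Ψ (ξ - η)) := by gcongr
          _ = _ := by ring
    _ = _ := by
        rw [lconv_apply, lconv_apply,
          ← lintegral_add_left' (f := fun η => ENNReal.ofReal ‖η‖ * Φ η * Ψ (ξ - η))]
        exact (hn.mul hΦ).mul hm

/-- Homogeneous weight distribution, second order:
`‖ξ‖² (Φ ⋆ₗ Ψ) ξ ≤ 2 (((‖·‖² Φ) ⋆ₗ Ψ) ξ + (Φ ⋆ₗ (‖·‖² Ψ)) ξ)` (`(a + b)² ≤ 2(a² + b²)`).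
[folklore] -/
theorem norm_sq_mul_lconv_le (hΦ : AEMeasurable Φ volume) (hΨ : AEMeasurable Ψ volume)
    (ξ : EuclideanSpace ℝ ι) :
    ENNReal.ofReal (‖ξ‖ ^ 2) * (Φ ⋆ₗ Ψ) ξ ≤
      2 * (((fun η => ENNReal.ofReal (‖η‖ ^ 2) * Φ η) ⋆ₗ Ψ) ξ +
        (Φ ⋆ₗ (fun η => ENNReal.ofReal (‖η‖ ^ 2) * Ψ η)) ξ) := by
  have hm := aemeasurable_comp_sub_left hΨ ξ
  have hn : AEMeasurable (fun η : EuclideanSpace ℝ ι => ENNReal.ofReal (‖η‖ ^ 2)) volume :=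
    (ENNReal.continuous_ofReal.comp (continuous_norm.pow 2)).measurable.aemeasurable
  calc ENNReal.ofReal (‖ξ‖ ^ 2) * (Φ ⋆ₗ Ψ) ξ
      = ∫⁻ η, ENNReal.ofReal (‖ξ‖ ^ 2) * (Φ η * Ψ (ξ - η)) := by
        rw [lconv_apply, lintegral_const_mul' _ _ ENNReal.ofReal_ne_top]
    _ ≤ ∫⁻ η, 2 * (ENNReal.ofReal (‖η‖ ^ 2) * Φ η * Ψ (ξ - η) +
          Φ η * (ENNReal.ofReal (‖ξ - η‖ ^ 2) * Ψ (ξ - η))) := by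
        refine lintegral_mono fun η => ?_
        have htri : ENNReal.ofReal (‖ξ‖ ^ 2) ≤
            2 * (ENNReal.ofReal (‖η‖ ^ 2) + ENNReal.ofReal (‖ξ - η‖ ^ 2)) := by
          have h1 : ‖ξ‖ ≤ ‖η‖ + ‖ξ - η‖ := by
            calc ‖ξ‖ = ‖η + (ξ - η)‖ := by rw [add_sub_cancel]
              _ ≤ ‖η‖ + ‖ξ - η‖ := norm_add_le _ _
          have h2 : ‖ξ‖ ^ 2 ≤ 2 * (‖η‖ ^ 2 + ‖ξ - η‖ ^ 2) := by
            calc ‖ξ‖ ^ 2 ≤ (‖η‖ + ‖ξ - η‖) ^ 2 := pow_le_pow_left₀ (norm_nonneg _) h1 2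
              _ ≤ 2 * (‖η‖ ^ 2 + ‖ξ - η‖ ^ 2) := by
                  nlinarith [sq_nonneg (‖η‖ - ‖ξ - η‖)]
          calc ENNReal.ofReal (‖ξ‖ ^ 2) ≤ ENNReal.ofReal (2 * (‖η‖ ^ 2 + ‖ξ - η‖ ^ 2)) :=
                ENNReal.ofReal_le_ofReal h2
            _ = _ := by
                rw [ENNReal.ofReal_mul (by norm_num), ENNReal.ofReal_add (by positivity)
                  (by positivity), ENNReal.ofReal_ofNat]
        calc ENNReal.ofReal (‖ξ‖ ^ 2) * (Φ η * Ψ (ξ - η))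
            ≤ 2 * (ENNReal.ofReal (‖η‖ ^ 2) + ENNReal.ofReal (‖ξ - η‖ ^ 2)) *
                (Φ η * Ψ (ξ - η)) := by gcongr
          _ = _ := by ring
    _ = _ := by
        rw [lintegral_const_mul' _ _ (by simp), lconv_apply, lconv_apply,
          ← lintegral_add_left' (f := fun η => ENNReal.ofReal (‖η‖ ^ 2) * Φ η * Ψ (ξ - η))]
        exact (hn.mul hΦ).mul hm

/-! ### Young's inequality `‖Φ ⋆ₗ Ψ‖₂ ≤ ‖Φ‖₂ ‖Ψ‖₁` and the `L¹` bound by weighted `L²` -/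

/-- Cauchy–Schwarz for `lintegral` in squared form: `(∫⁻ f g)² ≤ (∫⁻ f²) (∫⁻ g²)`. [folklore] -/
theorem sq_lintegral_mul_le {α : Type*} [MeasurableSpace α] (μ : Measure α) {f g : α → ℝ≥0∞}
    (hf : AEMeasurable f μ) (hg : AEMeasurable g μ) :
    (∫⁻ a, f a * g a ∂μ) ^ 2 ≤ (∫⁻ a, f a ^ 2 ∂μ) * ∫⁻ a, g a ^ 2 ∂μ := by
  have h := ENNReal.lintegral_mul_le_Lp_mul_Lq μ (Real.HolderConjugate.two_two) hf hg
  simp only [Pi.mul_apply] at h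
  rw [lintegral_rpow_two_eq, lintegral_rpow_two_eq] at h
  calc (∫⁻ a, f a * g a ∂μ) ^ 2
      ≤ ((∫⁻ a, f a ^ 2 ∂μ) ^ (1 / 2 : ℝ) * (∫⁻ a, g a ^ 2 ∂μ) ^ (1 / 2 : ℝ)) ^ 2 :=
        pow_le_pow_left' h 2
    _ = (∫⁻ a, f a ^ 2 ∂μ) * ∫⁻ a, g a ^ 2 ∂μ := by
        rw [mul_pow, ← ENNReal.rpow_natCast, ← ENNReal.rpow_natCast, ← ENNReal.rpow_mul,
          ← ENNReal.rpow_mul]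
        norm_num

/-- Pointwise Schur bound: `((Φ ⋆ₗ Ψ) ξ)² ≤ (∫⁻ Ψ) · (Φ² ⋆ₗ Ψ) ξ` (Cauchy–Schwarz with the
weight `Ψ(ξ - η)`). [folklore] -/
theorem lconv_sq_le (hΦ : AEMeasurable Φ volume) (hΨ : AEMeasurable Ψ volume)
    (ξ : EuclideanSpace ℝ ι) :
    (Φ ⋆ₗ Ψ) ξ ^ 2 ≤ (∫⁻ η, Ψ η) * ((fun η => Φ η ^ 2) ⋆ₗ Ψ) ξ := by
  have hm := aemeasurable_comp_sub_left hΨ ξ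
  -- `Φ(η) Ψ(ξ-η) = (Φ(η) Ψ(ξ-η)^{1/2}) · Ψ(ξ-η)^{1/2}`
  set R : EuclideanSpace ℝ ι → ℝ≥0∞ := fun η => Ψ (ξ - η) ^ (1 / 2 : ℝ) with hR
  have hRm : AEMeasurable R volume := hm.pow_const _
  have hR2 : ∀ η, R η ^ 2 = Ψ (ξ - η) := fun η => by
    rw [hR, ← ENNReal.rpow_natCast, ← ENNReal.rpow_mul]; norm_num
  have hsplit : ∀ η, Φ η * Ψ (ξ - η) = (Φ η * R η) * R η := fun η => by
    rw [mul_assoc, ← sq, hR2]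
  calc (Φ ⋆ₗ Ψ) ξ ^ 2 = (∫⁻ η, (Φ η * R η) * R η) ^ 2 := by
        rw [lconv_apply]; exact congrArg (· ^ 2) (lintegral_congr fun η => hsplit η)
    _ ≤ (∫⁻ η, (Φ η * R η) ^ 2) * ∫⁻ η, R η ^ 2 := sq_lintegral_mul_le _ (hΦ.mul hRm) hRm
    _ = ((fun η => Φ η ^ 2) ⋆ₗ Ψ) ξ * ∫⁻ η, Ψ η := by
        rw [lconv_apply]
        congr 1
        · exact lintegral_congr fun η => by rw [mul_pow, hR2]
        · rw [lintegral_congr fun η => hR2 η]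
          exact lintegral_sub_left_eq_self (μ := (volume : Measure (EuclideanSpace ℝ ι))) Ψ ξ
    _ = _ := mul_comm _ _

/-- Tonelli for `⋆ₗ`: `∫⁻ (Φ ⋆ₗ Ψ) = (∫⁻ Φ) (∫⁻ Ψ)`. [folklore] -/
theorem lintegral_lconv (hΦ : AEMeasurable Φ volume) (hΨ : AEMeasurable Ψ volume) :
    ∫⁻ ξ, (Φ ⋆ₗ Ψ) ξ = (∫⁻ η, Φ η) * ∫⁻ η, Ψ η := by
  simp only [lconv_apply]
  have hF : AEMeasurable (uncurry fun (ξ η : EuclideanSpace ℝ ι) => Φ η * Ψ (ξ - η))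
      (volume.prod volume) := by
    refine (hΦ.comp_quasiMeasurePreserving Measure.quasiMeasurePreserving_snd).mul ?_
    exact hΨ.comp_quasiMeasurePreserving (quasiMeasurePreserving_sub volume volume)
  rw [lintegral_lintegral_swap hF]
  have hmr : ∀ η : EuclideanSpace ℝ ι, AEMeasurable (fun ξ => Ψ (ξ - η)) volume := fun η =>
    hΨ.comp_quasiMeasurePreserving (measurePreserving_sub_right volume η).quasiMeasurePreserving
  calc ∫⁻ η, ∫⁻ ξ, Φ η * Ψ (ξ - η) = ∫⁻ η, Φ η * ∫⁻ ξ, Ψ ξ := by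
        refine lintegral_congr fun η => ?_
        rw [lintegral_const_mul'' _ (hmr η),
          lintegral_sub_right_eq_self (μ := (volume : Measure (EuclideanSpace ℝ ι))) Ψ η]
    _ = (∫⁻ η, Φ η) * ∫⁻ η, Ψ η := lintegral_mul_const'' _ hΦ

/-- **Young's inequality for the majorant convolution**, squared form:
`∫⁻ (Φ ⋆ₗ Ψ)² ≤ (∫⁻ Ψ)² ∫⁻ Φ²`, i.e. `‖Φ ⋆ₗ Ψ‖_{L²} ≤ ‖Φ‖_{L²} ‖Ψ‖_{L¹}`. [folklore] -/
theorem lintegral_lconv_sq_le (hΦ : AEMeasurable Φ volume) (hΨ : AEMeasurable Ψ volume) :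
    ∫⁻ ξ, (Φ ⋆ₗ Ψ) ξ ^ 2 ≤ (∫⁻ η, Ψ η) ^ 2 * ∫⁻ η, Φ η ^ 2 := by
  have hmeas : AEMeasurable (fun ξ => ((fun η => Φ η ^ 2) ⋆ₗ Ψ) ξ) volume :=
    aemeasurable_lconvolution (hΦ.pow_const 2) hΨ
  calc ∫⁻ ξ, (Φ ⋆ₗ Ψ) ξ ^ 2 ≤ ∫⁻ ξ, (∫⁻ η, Ψ η) * ((fun η => Φ η ^ 2) ⋆ₗ Ψ) ξ :=
        lintegral_mono fun ξ => lconv_sq_le hΦ hΨ ξ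
    _ = (∫⁻ η, Ψ η) * ∫⁻ ξ, ((fun η => Φ η ^ 2) ⋆ₗ Ψ) ξ := lintegral_const_mul'' _ hmeas
    _ = (∫⁻ η, Ψ η) * ((∫⁻ η, Φ η ^ 2) * ∫⁻ η, Ψ η) := by
        rw [lintegral_lconv (hΦ.pow_const 2) hΨ]
    _ = (∫⁻ η, Ψ η) ^ 2 * ∫⁻ η, Φ η ^ 2 := by ring

/-- The inverse weights `(1 + ‖ξ‖)^{-2m}` have finite integral for `2m > dim`. [folklore] -/
theorem lintegral_weight_inv_sq_lt_top {m : ℕ}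
    (hm : Module.finrank ℝ (EuclideanSpace ℝ ι) < 2 * m) :
    ∫⁻ ξ : EuclideanSpace ℝ ι, (ENNReal.ofReal ((1 + ‖ξ‖) ^ m))⁻¹ ^ 2 < ⊤ := by
  have hI := (integrable_inv_one_add_norm_pow (E := EuclideanSpace ℝ ι) hm).2
  rw [hasFiniteIntegral_iff_enorm] at hI
  refine lt_of_le_of_lt (le_of_eq (lintegral_congr fun ξ => ?_)) hI
  have hpos : (0 : ℝ) < (1 + ‖ξ‖) ^ m := by positivity
  rw [← ENNReal.ofReal_inv_of_pos hpos, ← ENNReal.ofReal_pow (by positivity),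
    Real.enorm_eq_ofReal (by positivity), ← inv_pow, ← pow_mul, mul_comm, inv_pow]

/-- **`L¹` is controlled by weighted `L²`**, squared form:
`(∫⁻ Φ)² ≤ (∫⁻ w^{-2m}) ∫⁻ (w^m Φ)²`, `w = 1 + ‖·‖` (Cauchy–Schwarz; the first factor is finite
for `2m > dim`, `lintegral_weight_inv_sq_lt_top`). [folklore] -/
theorem sq_lintegral_le_weight (hΦ : AEMeasurable Φ volume) (m : ℕ) :
    (∫⁻ ξ, Φ ξ) ^ 2 ≤
      (∫⁻ ξ : EuclideanSpace ℝ ι, (ENNReal.ofReal ((1 + ‖ξ‖) ^ m))⁻¹ ^ 2) *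
        ∫⁻ ξ, (ENNReal.ofReal ((1 + ‖ξ‖) ^ m) * Φ ξ) ^ 2 := by
  have hw : AEMeasurable (fun ξ : EuclideanSpace ℝ ι => ENNReal.ofReal ((1 + ‖ξ‖) ^ m)) volume :=
    (measurable_ofReal_weight m).aemeasurable
  calc (∫⁻ ξ, Φ ξ) ^ 2 = (∫⁻ ξ, (ENNReal.ofReal ((1 + ‖ξ‖) ^ m))⁻¹ *
        (ENNReal.ofReal ((1 + ‖ξ‖) ^ m) * Φ ξ)) ^ 2 := by
        congr 1
        refine lintegral_congr fun ξ => ?_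
        rw [← mul_assoc, ENNReal.inv_mul_cancel (ne_of_gt (lt_of_lt_of_le zero_lt_one
          (one_le_ofReal_weight m ξ))) ENNReal.ofReal_ne_top, one_mul]
    _ ≤ _ := sq_lintegral_mul_le _ hw.inv (hw.mul hΦ)

end LConv

/-! ### The frequency convolution `fconv` of square-integrable functions -/

section FConv

variable {f g g' : EuclideanSpace ℝ ι → ℂ}

/-- **`‖(f ⋆ g)(ξ)‖ₑ ≤ (‖f‖ₑ ⋆ₗ ‖g‖ₑ) ξ`**, unconditionally (if the integrand is not integrable
the convolution is `0`). [folklore] -/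
theorem enorm_fconv_le_lconv (f g : EuclideanSpace ℝ ι → ℂ) (ξ : EuclideanSpace ℝ ι) :
    ‖fconv f g ξ‖ₑ ≤ ((fun η => ‖f η‖ₑ) ⋆ₗ (fun η => ‖g η‖ₑ)) ξ := by
  rw [fconv_apply, lconv_apply]
  refine (enorm_integral_le_lintegral_enorm _).trans (le_of_eq (lintegral_congr fun η => ?_))
  rw [enorm_mul]

/-- `∫⁻ ‖f‖ₑ² = (eLpNorm f 2)²`. [folklore] -/
theorem lintegral_enorm_sq_eq_eLpNorm_sq {α : Type*} [MeasurableSpace α] (μ : Measure α)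
    {F : Type*} [ENorm F] (f : α → F) :
    ∫⁻ a, ‖f a‖ₑ ^ 2 ∂μ = eLpNorm f 2 μ ^ 2 := by
  rw [eLpNorm_eq_lintegral_rpow_enorm_toReal (by norm_num) (by norm_num), ENNReal.toReal_ofNat,
    ← ENNReal.rpow_natCast, ← ENNReal.rpow_mul]
  norm_num

/-- `(∫⁻ ‖f‖ₑ²)^{1/2} = eLpNorm f 2`. [folklore] -/
theorem lintegral_enorm_sq_rpow_half_eq_eLpNorm {α : Type*} [MeasurableSpace α] (μ : Measure α)
    {F : Type*} [ENorm F] (f : α → F) :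
    (∫⁻ a, ‖f a‖ₑ ^ 2 ∂μ) ^ (1 / 2 : ℝ) = eLpNorm f 2 μ := by
  rw [lintegral_enorm_sq_eq_eLpNorm_sq, ← ENNReal.rpow_natCast, ← ENNReal.rpow_mul]
  norm_num

/-- `(∫⁻ Θ²)^{1/2} = eLpNorm Θ 2` for an `ℝ≥0∞`-valued `Θ`. [folklore] -/
theorem lintegral_sq_rpow_half_eq_eLpNorm {α : Type*} [MeasurableSpace α] (μ : Measure α)
    (Θ : α → ℝ≥0∞) : (∫⁻ a, Θ a ^ 2 ∂μ) ^ (1 / 2 : ℝ) = eLpNorm Θ 2 μ := by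
  rw [← lintegral_enorm_sq_rpow_half_eq_eLpNorm]
  simp only [enorm_eq_self]

/-- **Cauchy–Schwarz for the frequency convolution**: `‖(f ⋆ g)(ξ)‖ₑ ≤ ‖f‖_{L²} ‖g‖_{L²}`
for all `ξ` (measurable `f`, `g`). [folklore] -/
theorem enorm_fconv_le (hf : AEStronglyMeasurable f volume) (hg : AEStronglyMeasurable g volume)
    (ξ : EuclideanSpace ℝ ι) :
    ‖fconv f g ξ‖ₑ ≤ eLpNorm f 2 volume * eLpNorm g 2 volume := by
  refine (enorm_fconv_le_lconv f g ξ).trans ?_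
  refine (lconv_le_sqrt_mul_sqrt hf.enorm hg.enorm ξ).trans (le_of_eq ?_)
  rw [lintegral_enorm_sq_rpow_half_eq_eLpNorm, lintegral_enorm_sq_rpow_half_eq_eLpNorm]

/-- **Pointwise polynomial decay of `L² ⋆ L²` from weighted `L²` bounds**:
`(1 + ‖ξ‖)^K ‖(f ⋆ g)(ξ)‖ₑ ≤ 2^K (‖f‖₂ ‖w^K g‖₂ + ‖w^K f‖₂ ‖g‖₂)` (Peetre + Cauchy–Schwarz) —
the convolution of two weighted-`L²` functions has the *pointwise* weighted bounds of the tree's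
class `HasDecay`. [folklore] -/
theorem weight_mul_enorm_fconv_le (hf : AEStronglyMeasurable f volume)
    (hg : AEStronglyMeasurable g volume) (K : ℕ) (ξ : EuclideanSpace ℝ ι) :
    ENNReal.ofReal ((1 + ‖ξ‖) ^ K) * ‖fconv f g ξ‖ₑ ≤
      2 ^ K * (eLpNorm f 2 volume *
          eLpNorm (fun η => ENNReal.ofReal ((1 + ‖η‖) ^ K) * ‖g η‖ₑ) 2 volume +
        eLpNorm (fun η => ENNReal.ofReal ((1 + ‖η‖) ^ K) * ‖f η‖ₑ) 2 volume *
          eLpNorm g 2 volume) := by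
  have hwf : AEMeasurable (fun η => ENNReal.ofReal ((1 + ‖η‖) ^ K) * ‖f η‖ₑ) volume :=
    (measurable_ofReal_weight K).aemeasurable.mul hf.enorm
  have hwg : AEMeasurable (fun η => ENNReal.ofReal ((1 + ‖η‖) ^ K) * ‖g η‖ₑ) volume :=
    (measurable_ofReal_weight K).aemeasurable.mul hg.enorm
  calc ENNReal.ofReal ((1 + ‖ξ‖) ^ K) * ‖fconv f g ξ‖ₑ
      ≤ ENNReal.ofReal ((1 + ‖ξ‖) ^ K) * ((fun η => ‖f η‖ₑ) ⋆ₗ (fun η => ‖g η‖ₑ)) ξ := by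
        gcongr; exact enorm_fconv_le_lconv f g ξ
    _ ≤ 2 ^ K * (((fun η => ‖f η‖ₑ) ⋆ₗ (fun η => ENNReal.ofReal ((1 + ‖η‖) ^ K) * ‖g η‖ₑ)) ξ +
          ((fun η => ENNReal.ofReal ((1 + ‖η‖) ^ K) * ‖f η‖ₑ) ⋆ₗ (fun η => ‖g η‖ₑ)) ξ) :=
        weight_mul_lconv_le hf.enorm hg.enorm K ξ
    _ ≤ 2 ^ K * ((∫⁻ η, ‖f η‖ₑ ^ 2) ^ (1 / 2 : ℝ) *
          (∫⁻ η, (ENNReal.ofReal ((1 + ‖η‖) ^ K) * ‖g η‖ₑ) ^ 2) ^ (1 / 2 : ℝ) +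
          (∫⁻ η, (ENNReal.ofReal ((1 + ‖η‖) ^ K) * ‖f η‖ₑ) ^ 2) ^ (1 / 2 : ℝ) *
            (∫⁻ η, ‖g η‖ₑ ^ 2) ^ (1 / 2 : ℝ)) := by
        gcongr
        · exact lconv_le_sqrt_mul_sqrt hf.enorm hwg ξ
        · exact lconv_le_sqrt_mul_sqrt hwf hg.enorm ξ
    _ = _ := by
        rw [lintegral_enorm_sq_rpow_half_eq_eLpNorm, lintegral_enorm_sq_rpow_half_eq_eLpNorm,
          lintegral_sq_rpow_half_eq_eLpNorm, lintegral_sq_rpow_half_eq_eLpNorm]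

/-- The translate-reflection `η ↦ g (ξ - η)` of an `L²` function is in `L²`. [folklore] -/
theorem memLp_comp_sub_left (hg : MemLp g 2 volume) (ξ : EuclideanSpace ℝ ι) :
    MemLp (fun η => g (ξ - η)) 2 volume :=
  hg.comp_measurePreserving (Measure.measurePreserving_sub_left volume ξ)

/-- **Integrability of the convolution integrand** `η ↦ f η * g (ξ - η)` for `f, g ∈ L²`.
[folklore] -/
theorem integrable_fconv_integrand (hf : MemLp f 2 volume) (hg : MemLp g 2 volume)
    (ξ : EuclideanSpace ℝ ι) : Integrable (fun η => f η * g (ξ - η)) volume :=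
  hf.integrable_mul (memLp_comp_sub_left hg ξ)

/-- `fconv f g - fconv f g' = fconv f (g - g')` pointwise, for `L²` factors. [folklore] -/
theorem fconv_sub_right_of_memLp (hf : MemLp f 2 volume) (hg : MemLp g 2 volume)
    (hg' : MemLp g' 2 volume) (ξ : EuclideanSpace ℝ ι) :
    fconv f g ξ - fconv f g' ξ = fconv f (g - g') ξ :=
  (fconv_sub_right (integrable_fconv_integrand hf hg ξ) (integrable_fconv_integrand hf hg' ξ)).symm

/-- `fconv f g - fconv f' g = fconv (f - f') g` pointwise, for `L²` factors. [folklore] -/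
theorem fconv_sub_left_of_memLp {f' : EuclideanSpace ℝ ι → ℂ} (hf : MemLp f 2 volume)
    (hf' : MemLp f' 2 volume) (hg : MemLp g 2 volume) (ξ : EuclideanSpace ℝ ι) :
    fconv f g ξ - fconv f' g ξ = fconv (f - f') g ξ :=
  (fconv_sub_left (integrable_fconv_integrand hf hg ξ) (integrable_fconv_integrand hf' hg ξ)).symm

/-- **Continuity of `f ⋆ g` for `f ∈ L²` and `g ∈ C_c`** (Mathlib
`HasCompactSupport.continuous_convolution_right`). [folklore] -/
theorem continuous_fconv_of_hasCompactSupport (hf : MemLp f 2 volume) (hg : Continuous g)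
    (hgs : HasCompactSupport g) : Continuous (fconv f g) := by
  rw [show fconv f g = f ⋆[ContinuousLinearMap.mul ℂ ℂ] g from rfl]
  exact hgs.continuous_convolution_right _ (hf.locallyIntegrable (by norm_num)) hg

/-- **Continuity of the convolution of two `L²` functions.** `f ⋆ g` is a uniform limit of the
continuous functions `f ⋆ gₙ`, `gₙ ∈ C_c` with `‖g - gₙ‖_{L²} → 0` (density of `C_c` in `L²`
and the uniform bound `‖(f ⋆ (g - gₙ))(ξ)‖ ≤ ‖f‖₂ ‖g - gₙ‖₂`). [folklore] -/
theorem continuous_fconv_of_memLp (hf : MemLp f 2 volume) (hg : MemLp g 2 volume) :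
    Continuous (fconv f g) := by
  -- approximants `gₙ ∈ C_c` with `‖g - gₙ‖₂ ≤ 1/(n+1)`
  have happrox : ∀ n : ℕ, ∃ gn : EuclideanSpace ℝ ι → ℂ, HasCompactSupport gn ∧
      eLpNorm (g - gn) 2 volume ≤ ENNReal.ofReal (1 / ((n : ℝ) + 1)) ∧ Continuous gn ∧
      MemLp gn 2 volume := fun n =>
    hg.exists_hasCompactSupport_eLpNorm_sub_le (by norm_num)
      (by rw [ne_eq, ENNReal.ofReal_eq_zero, not_le]; positivity)
  choose gn hgs hgn hgc hgm using happrox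
  have hcont : ∀ n, Continuous (fconv f (gn n)) := fun n =>
    continuous_fconv_of_hasCompactSupport hf (hgc n) (hgs n)
  suffices hunif : TendstoUniformly (fun n => fconv f (gn n)) (fconv f g) atTop from
    hunif.continuous (Frequently.of_forall hcont)
  rw [Metric.tendstoUniformly_iff]
  intro ε hε
  -- `‖f ⋆ g (ξ) - f ⋆ gₙ (ξ)‖ ≤ ‖f‖₂ / (n+1)`
  set A : ℝ := (eLpNorm f 2 volume).toReal with hA
  have hA0 : 0 ≤ A := ENNReal.toReal_nonneg
  obtain ⟨N, hN⟩ := exists_nat_gt (A / ε)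
  refine eventually_atTop.2 ⟨N, fun n hn ξ => ?_⟩
  have hn1 : A / ((n : ℝ) + 1) < ε := by
    have hN' : A / ε < (n : ℝ) + 1 := hN.trans_le (by exact_mod_cast Nat.le_succ_of_le hn)
    rw [div_lt_iff₀ hε] at hN'
    rw [div_lt_iff₀ (by positivity)]
    linarith [mul_comm ε ((n : ℝ) + 1)]
  have hbound : ‖fconv f g ξ - fconv f (gn n) ξ‖ₑ ≤
      eLpNorm f 2 volume * ENNReal.ofReal (1 / ((n : ℝ) + 1)) := by
    rw [fconv_sub_right_of_memLp hf hg (hgm n) ξ]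
    exact (enorm_fconv_le hf.1 (hg.sub (hgm n)).1 ξ).trans (by gcongr; exact hgn n)
  rw [dist_eq_norm, ← toReal_enorm]
  refine lt_of_le_of_lt (ENNReal.toReal_mono (ENNReal.mul_ne_top hf.eLpNorm_ne_top
    ENNReal.ofReal_ne_top) hbound) ?_
  rw [ENNReal.toReal_mul, ENNReal.toReal_ofReal (by positivity), ← hA, mul_one_div]
  exact hn1

/-- **Joint continuity of the convolution of `L²`-continuous families.** If `x ↦ F x` and
`x ↦ G x` are families of `L²` functions, continuous in the `L²` norm, then
`(x, ξ) ↦ (F x ⋆ G x)(ξ)` is jointly continuous: in `ξ` by `continuous_fconv_of_memLp`, and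
uniformly Lipschitz in the `L²` distance of the factors by Cauchy–Schwarz. [folklore] -/
theorem continuous_fconv_family {X : Type*} [TopologicalSpace X]
    {F G : X → EuclideanSpace ℝ ι → ℂ}
    (hF : ∀ x, MemLp (F x) 2 volume) (hG : ∀ x, MemLp (G x) 2 volume)
    (hFc : ∀ x₀, Tendsto (fun x => eLpNorm (F x - F x₀) 2 volume) (𝓝 x₀) (𝓝 0))
    (hGc : ∀ x₀, Tendsto (fun x => eLpNorm (G x - G x₀) 2 volume) (𝓝 x₀) (𝓝 0)) :
    Continuous fun p : X × EuclideanSpace ℝ ι => fconv (F p.1) (G p.1) p.2 := by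
  refine continuous_iff_continuousAt.2 fun p₀ => ?_
  obtain ⟨x₀, ξ₀⟩ := p₀
  rw [ContinuousAt, tendsto_iff_edist_tendsto_0]
  -- the bound
  set eF : X → ℝ≥0∞ := fun x => eLpNorm (F x - F x₀) 2 volume with heF
  set eG : X → ℝ≥0∞ := fun x => eLpNorm (G x - G x₀) 2 volume with heG
  set A : ℝ≥0∞ := eLpNorm (F x₀) 2 volume with hA
  set B : ℝ≥0∞ := eLpNorm (G x₀) 2 volume with hB
  set third : EuclideanSpace ℝ ι → ℝ≥0∞ := fun ξ =>
    ‖fconv (F x₀) (G x₀) ξ - fconv (F x₀) (G x₀) ξ₀‖ₑ with hthird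
  have hbound : ∀ p : X × EuclideanSpace ℝ ι,
      edist (fconv (F p.1) (G p.1) p.2) (fconv (F x₀) (G x₀) ξ₀) ≤
        eF p.1 * (eG p.1 + B) + A * eG p.1 + third p.2 := by
    rintro ⟨x, ξ⟩
    rw [edist_eq_enorm_sub]
    have h1 : ‖fconv (F x) (G x) ξ - fconv (F x₀) (G x) ξ‖ₑ ≤ eF x * (eG x + B) := by
      rw [fconv_sub_left_of_memLp (hF x) (hF x₀) (hG x) ξ]
      refine (enorm_fconv_le ((hF x).sub (hF x₀)).1 (hG x).1 ξ).trans ?_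
      gcongr
      calc eLpNorm (G x) 2 volume = eLpNorm ((G x - G x₀) + G x₀) 2 volume := by
            rw [sub_add_cancel]
        _ ≤ eG x + B := eLpNorm_add_le ((hG x).sub (hG x₀)).1 (hG x₀).1 one_le_two
    have h2 : ‖fconv (F x₀) (G x) ξ - fconv (F x₀) (G x₀) ξ‖ₑ ≤ A * eG x := by
      rw [fconv_sub_right_of_memLp (hF x₀) (hG x) (hG x₀) ξ]
      exact enorm_fconv_le (hF x₀).1 ((hG x).sub (hG x₀)).1 ξ
    calc ‖fconv (F x) (G x) ξ - fconv (F x₀) (G x₀) ξ₀‖ₑ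
        = ‖(fconv (F x) (G x) ξ - fconv (F x₀) (G x) ξ) +
            (fconv (F x₀) (G x) ξ - fconv (F x₀) (G x₀) ξ) +
            (fconv (F x₀) (G x₀) ξ - fconv (F x₀) (G x₀) ξ₀)‖ₑ := by
          congr 1; ring
      _ ≤ ‖fconv (F x) (G x) ξ - fconv (F x₀) (G x) ξ‖ₑ +
            ‖fconv (F x₀) (G x) ξ - fconv (F x₀) (G x₀) ξ‖ₑ +
            ‖fconv (F x₀) (G x₀) ξ - fconv (F x₀) (G x₀) ξ₀‖ₑ :=
          (enorm_add_le _ _).trans (by gcongr; exact enorm_add_le _ _)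
      _ ≤ eF x * (eG x + B) + A * eG x + third ξ := by
          gcongr
  -- the bound tends to zero
  have hFx : Tendsto (fun p : X × EuclideanSpace ℝ ι => eF p.1) (𝓝 (x₀, ξ₀)) (𝓝 0) :=
    (hFc x₀).comp (continuous_fst.tendsto (x₀, ξ₀))
  have hGx : Tendsto (fun p : X × EuclideanSpace ℝ ι => eG p.1) (𝓝 (x₀, ξ₀)) (𝓝 0) :=
    (hGc x₀).comp (continuous_fst.tendsto (x₀, ξ₀))
  have hthird0 : Tendsto (fun p : X × EuclideanSpace ℝ ι => third p.2) (𝓝 (x₀, ξ₀)) (𝓝 0) := by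
    have hc := (continuous_fconv_of_memLp (hF x₀) (hG x₀)).tendsto ξ₀
    rw [tendsto_iff_edist_tendsto_0] at hc
    simp only [edist_eq_enorm_sub] at hc
    exact hc.comp (continuous_snd.tendsto (x₀, ξ₀))
  have hlim : Tendsto (fun p : X × EuclideanSpace ℝ ι => eF p.1 * (eG p.1 + B) + A * eG p.1 +
      third p.2) (𝓝 (x₀, ξ₀)) (𝓝 0) := by
    have hB : B ≠ ⊤ := (hG x₀).eLpNorm_ne_top
    have hA' : A ≠ ⊤ := (hF x₀).eLpNorm_ne_top
    have h1 : Tendsto (fun p : X × EuclideanSpace ℝ ι => eF p.1 * (eG p.1 + B)) (𝓝 (x₀, ξ₀))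
        (𝓝 (0 * (0 + B))) :=
      ENNReal.Tendsto.mul hFx (Or.inr (by simpa using hB)) (hGx.add tendsto_const_nhds)
        (Or.inr ENNReal.zero_ne_top)
    have h2 : Tendsto (fun p : X × EuclideanSpace ℝ ι => A * eG p.1) (𝓝 (x₀, ξ₀)) (𝓝 (A * 0)) :=
      ENNReal.Tendsto.const_mul hGx (Or.inr hA')
    rw [zero_mul] at h1
    rw [mul_zero] at h2
    simpa using (h1.add h2).add hthird0
  exact tendsto_of_tendsto_of_tendsto_of_le_of_le tendsto_const_nhds hlim
    (fun p => zero_le) hbound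

end FConv

end Literature.Analysis.FluidPDE.FourierNS

end
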